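import Literature.AlgebraicGeometry.Deformation.LiftedTransitions
import Literature.AlgebraicGeometry.Deformation.MorphismLiftsSquareZeroAffine
import Mathlib.Algebra.BigOperators.Fin
import HarnessLib

/-!
# Locality of linear relations between the differences `u_j♯ − u₀♯` of morphisms agreeing on a first-order thickening

Layer `Literature/AlgebraicGeometry/Deformation`, namespace `Literature.AlgebraicGeometry.Deformation`.  THEOREMS ONLY (no
definition, no named fact, no instance, no notation, no `sorry`).

Setting ([Hartshorne2010] §6, proof of Thm. 6.4; [StacksProject] Tag 08KY): `i : X ⟶ X'` a first-order thickening (ideal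
`𝓘 = Ker(i♯)` of square zero), `u₀, u_j : X' ⟶ Y` morphisms which AGREE ON `X` (`i ≫ u_j = i ≫ u₀`).  For an open `U ⊆ Y`, a
section `g ∈ Γ(Y, U)` and an open `V ⊆ u₀⁻¹U` of `X'` the DIFFERENCE `D_j(g) := u_j♯(g)|_V − u₀♯(g)|_V ∈ Γ(X', V)`
(through Mathlib's `Scheme.Hom.appLE`) is killed by `i♯`, i.e. it is a section of `𝓘`; hence products of two differences
vanish (`𝓘² = 0`) and `D_j` satisfies the Leibniz rule `D_j(gh) = u₀♯(h) D_j(g) + u₀♯(g) D_j(h)` — `D_j` is «the derivation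
`u_j − u₀`» of [SGA1] Exp. III §5 / [Hartshorne2010] §6.

* `app_appLE_sub_appLE` — `i♯(D_j(g)) = 0`.
* `appLE_sub_appLE_mul_appLE_sub_appLE` — `D_j(g) · D_k(h) = 0`.
* **`sum_mul_appLE_sub_appLE_eq_zero_of_forall_affineOpen`** (the locality theorem) — a LINEAR RELATION
  `Σ_j a_j|_V · D_j(g) = 0` with GLOBAL coefficients `a_j ∈ Γ(X', 𝒪)` which holds for all sections `s` over the members
  `Q_k` of a family of AFFINE opens of `Y`, on opens `W_k ⊆ u⁻¹Q_k` covering `X'`, holds for EVERY section `g ∈ Γ(Y, U)` over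
  EVERY open `U` on EVERY `V ⊆ u⁻¹U`: write `g = s / fⁿ` on a basic open `D(f) ⊆ U ∩ Q_k` (`Q_k` affine: Mathlib
  `IsAffineOpen.exists_basicOpen_le`, `IsAffineOpen.isLocalization_basicOpen`), use Leibniz and `𝓘² = 0` to get
  `u₀♯(fⁿ) · Σ a_j D_j(g) = Σ a_j D_j(s) − u₀♯(g) Σ a_j D_j(fⁿ) = 0` with `u₀♯(fⁿ)` a unit on `u₀⁻¹D(f)`, and glue over `V`
  (the structure sheaf is a sheaf).
* **`appLE_sub_eq_mul_sub_of_forall_affineOpen`** (three morphisms, `D₂ = λ · D₁`: HOMOGENEITY) and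
  **`appLE_sub_eq_add_sub_of_forall_affineOpen`** (four morphisms, `D₃ = D₁ + D₂`: ADDITIVITY) — the two instances consumed
  by the Kodaira–Spencer count of the cell's (Mc) N3′ letter S-e: the sectionwise relations proved on PRODUCT-AFFINE opens of
  `A ×_S A` (tree-bound `AbelianSchemes/InfinitesimalPointDifferenceSections`, [MumfordAV1970] §13 p. 126) are thereby
  transported to ALL transition functions of a Čech cocycle of units, which is the hypothesis `hprop` of the tree-bound
  `Deformation/FirstOrderPairUnitsClassShift.cechToH_eq_map_of_sub_eq_mul_sub` — product-affine opens are NOT a basis of the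
  topology of `A ×_S A`, so this localisation step is necessary.

Cell `hodgecm-mathlib` (D-0151), FLOOR 0, P1 F-3 (Mc) N3′ S-e, brick K3 («J7-cover»); author F0P1c-p03 (g0).  HC_CM is proved only
modulo the 7 printed citations until rung 0 closes; nothing here is about HC.

## References
* [Hartshorne2010] R. Hartshorne, *Deformation Theory*, GTM 257 (2010), §6, proof of Thm. 6.4 (pp. 50–51).
* [StacksProject] The Stacks Project, Tag 08KY (first-order thickenings).
* [SGA1] A. Grothendieck, SGA 1, Exp. III §5 (morphisms agreeing modulo a square-zero ideal differ by a derivation).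
* [MumfordAV1970] D. Mumford, *Abelian Varieties* (1970), §13, proof of the Theorem (pp. 125–126).
-/

noncomputable section

universe u

open CategoryTheory Opposite TopologicalSpace AlgebraicGeometry

namespace Literature.AlgebraicGeometry.Deformation

open Literature.AlgebraicGeometry.Modules

variable {X X' Y : Scheme.{u}} (i : X ⟶ X')

/-! ### §1 The difference of two morphisms agreeing on `X` is killed by `i♯`; products of differences vanish -/

omit i in
/-- Congruence of `Scheme.Hom.appLE` in the morphism. [folklore] -/
private theorem appLE_congr_of_eq {f g : X' ⟶ Y} (e : f = g) (U : Y.Opens) (V : X'.Opens) (hf : V ≤ f ⁻¹ᵁ U)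
    (hg : V ≤ g ⁻¹ᵁ U) : f.appLE U V hf = g.appLE U V hg := by
  subst e; rfl

omit i in
/-- `appLE` and restriction in the source: `(u♯ g)|_{V'} = u♯_{V'} g`. [folklore] -/
private theorem secRes_appLE (u : X' ⟶ Y) (U : Y.Opens) {V V' : X'.Opens} (h : V ≤ u ⁻¹ᵁ U) (hle : V' ≤ V)
    (g : Γ(Y, U)) : secRes X' hle (u.appLE U V h g) = u.appLE U V' (hle.trans h) g := by
  change (u.appLE U V h ≫ X'.presheaf.map (homOfLE hle).op) g = _
  rw [Scheme.Hom.appLE_map]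

omit i in
/-- `appLE` and restriction in the target: `u♯_V (g|_{U'}) = u♯_V g`. [folklore] -/
private theorem appLE_secRes (u : X' ⟶ Y) {U U' : Y.Opens} (hU : U' ≤ U) {V : X'.Opens} (h' : V ≤ u ⁻¹ᵁ U')
    (g : Γ(Y, U)) : u.appLE U' V h' (secRes Y hU g) = u.appLE U V (h'.trans fun _ hx => hU hx) g := by
  change (Y.presheaf.map (homOfLE hU).op ≫ u.appLE U' V h') g = _
  rw [Scheme.Hom.map_appLE]

/-- **The difference `u₁♯ − u₀♯` of two morphisms agreeing on `X` is killed by `i♯`**: for `i ≫ u₁ = i ≫ u₀`, every section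
`g ∈ Γ(Y, U)` and `V ⊆ u₀⁻¹U ∩ u₁⁻¹U`, `i♯_V (u₁♯ g − u₀♯ g) = 0` — both terms are `(i ≫ u)♯ g` on `i⁻¹V`.
[cite: Hartshorne2010, §6 proof of Thm. 6.4, pp. 50–51] [cite: StacksProject, Tag 08KY] -/
theorem app_appLE_sub_appLE (u₀ u₁ : X' ⟶ Y) (hu : i ≫ u₁ = i ≫ u₀) (U : Y.Opens) (V : X'.Opens)
    (h₀ : V ≤ u₀ ⁻¹ᵁ U) (h₁ : V ≤ u₁ ⁻¹ᵁ U) (g : Γ(Y, U)) :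
    i.app V (u₁.appLE U V h₁ g - u₀.appLE U V h₀ g) = 0 := by
  have key : ∀ (u : X' ⟶ Y) (h : V ≤ u ⁻¹ᵁ U),
      i.app V (u.appLE U V h g) = (i ≫ u).appLE U (i ⁻¹ᵁ V)
        (fun x hx => show (i ≫ u).base x ∈ U from h hx) g := by
    intro u h
    rw [Scheme.Hom.app_eq_appLE]
    change (u.appLE U V h ≫ i.appLE V (i ⁻¹ᵁ V) le_rfl) g = _
    rw [Scheme.Hom.appLE_comp_appLE]
  rw [map_sub, key u₁ h₁, key u₀ h₀,
    appLE_congr_of_eq hu U (i ⁻¹ᵁ V) _ (fun x hx => show (i ≫ u₀).base x ∈ U from h₀ hx), sub_self]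

/-- **Products of differences vanish** (`𝓘² = 0` on a first-order thickening): for `u_j, u_k` agreeing with `u₀` on `X`,
`(u_j♯ g − u₀♯ g) · (u_k♯ h − u₀♯ h) = 0` in `Γ(X', V)`. [cite: StacksProject, Tag 08KY]
[cite: Hartshorne2010, §6 proof of Thm. 6.4, pp. 50–51] -/
theorem appLE_sub_appLE_mul_appLE_sub_appLE [IsFirstOrderThickening i] (u₀ u₁ u₂ : X' ⟶ Y)
    (hu₁ : i ≫ u₁ = i ≫ u₀) (hu₂ : i ≫ u₂ = i ≫ u₀) {U U' : Y.Opens} {V : X'.Opens}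
    (h₀ : V ≤ u₀ ⁻¹ᵁ U) (h₁ : V ≤ u₁ ⁻¹ᵁ U) (h₀' : V ≤ u₀ ⁻¹ᵁ U') (h₂' : V ≤ u₂ ⁻¹ᵁ U')
    (g : Γ(Y, U)) (h : Γ(Y, U')) :
    (u₁.appLE U V h₁ g - u₀.appLE U V h₀ g) * (u₂.appLE U' V h₂' h - u₀.appLE U' V h₀' h) = 0 :=
  mul_eq_zero_of_app_eq_zero i (app_appLE_sub_appLE i u₀ u₁ hu₁ U V h₀ h₁ g)
    (app_appLE_sub_appLE i u₀ u₂ hu₂ U' V h₀' h₂' h)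

/-! ### §2 The locality theorem for linear relations between the differences -/

section Locality

variable [IsFirstOrderThickening i] {ι : Type*} [Fintype ι] (u₀ : X' ⟶ Y) (u : ι → (X' ⟶ Y))
  (hu : ∀ j, i ≫ u j = i ≫ u₀) (a : ι → Γ(X', ⊤))

include hu in
/-- **Leibniz for the linear combination of differences, modulo `𝓘² = 0`**: with `L_V(g) := Σ_j a_j|_V (u_j♯ g − u₀♯ g)`,
`L_V(g · h) = u₀♯(h) · L_V(g) + u₀♯(g) · L_V(h)`. [cite: Hartshorne2010, §6 proof of Thm. 6.4, pp. 50–51]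
[cite: StacksProject, Tag 08KY] -/
theorem sum_mul_appLE_sub_appLE_mul {U : Y.Opens} {V : X'.Opens} (h₀ : V ≤ u₀ ⁻¹ᵁ U)
    (h : ∀ j, V ≤ (u j) ⁻¹ᵁ U) (g g' : Γ(Y, U)) :
    (∑ j, secRes X' (le_top : V ≤ ⊤) (a j) * ((u j).appLE U V (h j) (g * g') - u₀.appLE U V h₀ (g * g'))) =
      u₀.appLE U V h₀ g' * ∑ j, secRes X' (le_top : V ≤ ⊤) (a j) * ((u j).appLE U V (h j) g - u₀.appLE U V h₀ g) +
      u₀.appLE U V h₀ g * ∑ j, secRes X' (le_top : V ≤ ⊤) (a j) * ((u j).appLE U V (h j) g' - u₀.appLE U V h₀ g') := by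
  rw [Finset.mul_sum, Finset.mul_sum, ← Finset.sum_add_distrib]
  refine Finset.sum_congr rfl fun j _ => ?_
  have hz := appLE_sub_appLE_mul_appLE_sub_appLE i u₀ (u j) (u j) (hu j) (hu j) h₀ (h j) h₀ (h j) g g'
  rw [map_mul, map_mul]
  linear_combination (secRes X' (le_top : V ≤ ⊤) (a j)) * hz

include hu in
/-- **LOCALITY OF LINEAR RELATIONS BETWEEN DIFFERENCES OF MORPHISMS AGREEING ON A FIRST-ORDER THICKENING.**  Let `i : X ⟶ X'` be
a first-order thickening, `u₀, u_j : X' ⟶ Y` (`j` in a finite index type) with `i ≫ u_j = i ≫ u₀`, and `a_j ∈ Γ(X', 𝒪_{X'})`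
global coefficients.  Suppose given AFFINE opens `Q_k ⊆ Y` and opens `W_k ⊆ u₀⁻¹Q_k ∩ ⋂_j u_j⁻¹Q_k` of `X'` COVERING `X'` such
that for every `k` and every section `s ∈ Γ(Y, Q_k)` the relation `Σ_j a_j|_{W_k} · (u_j♯ s − u₀♯ s) = 0` holds in
`Γ(X', W_k)`.  Then for EVERY open `U ⊆ Y`, EVERY `g ∈ Γ(Y, U)` and EVERY open `V ⊆ u₀⁻¹U ∩ ⋂_j u_j⁻¹U`:
`Σ_j a_j|_V · (u_j♯ g − u₀♯ g) = 0` in `Γ(X', V)`.  (Locally `g = s∕fⁿ` on a basic open `D(f) ⊆ U ∩ Q_k` of the affine `Q_k`;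
Leibniz and `𝓘² = 0` give `u₀♯(fⁿ) · Σ a_j D_j(g) = 0` with `u₀♯(fⁿ)` invertible; glue.)
[cite: Hartshorne2010, §6 proof of Thm. 6.4, pp. 50–51] [cite: StacksProject, Tag 08KY] [cite: SGA1, Exp. III §5 Prop. 5.1] -/
theorem sum_mul_appLE_sub_appLE_eq_zero_of_forall_affineOpen {κ : Type*} (Q : κ → Y.Opens)
    (hQ : ∀ k, IsAffineOpen (Q k)) (W : κ → X'.Opens) (hW₀ : ∀ k, W k ≤ u₀ ⁻¹ᵁ Q k)
    (hW : ∀ k j, W k ≤ (u j) ⁻¹ᵁ Q k) (hcov : ∀ x : X', ∃ k, x ∈ W k)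
    (hrel : ∀ (k) (s : Γ(Y, Q k)),
      (∑ j, secRes X' (le_top : W k ≤ ⊤) (a j) * ((u j).appLE (Q k) (W k) (hW k j) s - u₀.appLE (Q k) (W k) (hW₀ k) s)) = 0)
    (U : Y.Opens) (g : Γ(Y, U)) (V : X'.Opens) (h₀ : V ≤ u₀ ⁻¹ᵁ U) (h : ∀ j, V ≤ (u j) ⁻¹ᵁ U) :
    (∑ j, secRes X' (le_top : V ≤ ⊤) (a j) * ((u j).appLE U V (h j) g - u₀.appLE U V h₀ g)) = 0 := by
  classical
  -- restriction of the linear combination to a smaller open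
  have hres : ∀ {V V' : X'.Opens} (hle : V' ≤ V) (h₀ : V ≤ u₀ ⁻¹ᵁ U) (h : ∀ j, V ≤ (u j) ⁻¹ᵁ U),
      secRes X' hle (∑ j, secRes X' (le_top : V ≤ ⊤) (a j) * ((u j).appLE U V (h j) g - u₀.appLE U V h₀ g)) =
        ∑ j, secRes X' (le_top : V' ≤ ⊤) (a j) *
          ((u j).appLE U V' (hle.trans (h j)) g - u₀.appLE U V' (hle.trans h₀) g) := by
    intro V V' hle h₀ h
    rw [map_sum]
    refine Finset.sum_congr rfl fun j _ => ?_
    rw [map_mul, map_sub, secRes_secRes, secRes_appLE, secRes_appLE]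
  -- it suffices to prove the vanishing locally on `V`
  suffices hloc : ∀ x : X', x ∈ V → ∃ V' : X'.Opens, x ∈ V' ∧ ∃ hle : V' ≤ V,
      (∑ j, secRes X' (le_top : V' ≤ ⊤) (a j) *
        ((u j).appLE U V' (hle.trans (h j)) g - u₀.appLE U V' (hle.trans h₀) g)) = 0 by
    choose V' hxV' hle hV' using hloc
    refine X'.sheaf.eq_of_locally_eq' (fun x : V => V' x.1 x.2) V (fun x => homOfLE (hle x.1 x.2))
      (fun x hx => Opens.mem_iSup.2 ⟨⟨x, hx⟩, hxV' x hx⟩) _ _ fun x => ?_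
    change secRes X' (hle x.1 x.2) _ = secRes X' (hle x.1 x.2) 0
    rw [map_zero, hres (hle x.1 x.2) h₀ h, hV']
  intro x hx
  -- an affine `Q k` through `u₀ x`, a basic open `D(f) ⊆ U ∩ Q k` around `u₀ x`, and `g = s / fⁿ` on `D(f)`
  obtain ⟨k, hxW⟩ := hcov x
  have hyQ : u₀.base x ∈ Q k := hW₀ k hxW
  have hyU : u₀.base x ∈ U := h₀ hx
  obtain ⟨f, hfU, hyf⟩ := (hQ k).exists_basicOpen_le (V := U) ⟨u₀.base x, hyU⟩ hyQ
  have hfQ : Y.basicOpen f ≤ Q k := Y.basicOpen_le f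
  letI := (hQ k).isLocalization_basicOpen f
  obtain ⟨⟨s, ⟨t, n, rfl⟩⟩, hst⟩ := IsLocalization.surj (Submonoid.powers f) (secRes Y hfU g)
  change secRes Y hfU g * secRes Y hfQ (f ^ n) = secRes Y hfQ s at hst
  -- the open `V' := V ∩ W k ∩ u₀⁻¹D(f)` around `x`
  refine ⟨V ⊓ W k ⊓ u₀ ⁻¹ᵁ Y.basicOpen f, ⟨⟨hx, hxW⟩, hyf⟩, inf_le_left.trans inf_le_left, ?_⟩
  set V' : X'.Opens := V ⊓ W k ⊓ u₀ ⁻¹ᵁ Y.basicOpen f with hV'def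
  have hV'V : V' ≤ V := inf_le_left.trans inf_le_left
  have hV'W : V' ≤ W k := inf_le_left.trans inf_le_right
  have hV'f₀ : V' ≤ u₀ ⁻¹ᵁ Y.basicOpen f := inf_le_right
  have hV'f : ∀ j, V' ≤ (u j) ⁻¹ᵁ Y.basicOpen f := fun j => by
    rw [preimage_eq_of_comp_eq i (hu j) (Y.basicOpen f)]; exact hV'f₀
  -- names for the pulled-back sections on `V'`
  -- `G_j = u_j♯ g`, `H_j = u_j♯ (fⁿ)`, `S_j = u_j♯ s`, with `G_j H_j = S_j`
  have hGHS : ∀ (v : X' ⟶ Y) (hvU : V' ≤ v ⁻¹ᵁ U) (hvQ : V' ≤ v ⁻¹ᵁ Q k) (hvf : V' ≤ v ⁻¹ᵁ Y.basicOpen f),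
      v.appLE U V' hvU g * v.appLE (Q k) V' hvQ (f ^ n) = v.appLE (Q k) V' hvQ s := by
    intro v hvU hvQ hvf
    have e := congrArg (v.appLE (Y.basicOpen f) V' hvf) hst
    rw [map_mul, appLE_secRes, appLE_secRes, appLE_secRes] at e
    exact e
  -- the relations for `s` and `fⁿ`, restricted from `W k` to `V'`
  have hrelS : (∑ j, secRes X' (le_top : V' ≤ ⊤) (a j) *
      ((u j).appLE (Q k) V' (hV'W.trans (hW k j)) s - u₀.appLE (Q k) V' (hV'W.trans (hW₀ k)) s)) = 0 := by
    have e := congrArg (secRes X' hV'W) (hrel k s)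
    rw [map_zero, map_sum] at e
    rw [← e]
    refine Finset.sum_congr rfl fun j _ => ?_
    rw [map_mul, map_sub, secRes_secRes, secRes_appLE, secRes_appLE]
  have hrelH : (∑ j, secRes X' (le_top : V' ≤ ⊤) (a j) *
      ((u j).appLE (Q k) V' (hV'W.trans (hW k j)) (f ^ n) - u₀.appLE (Q k) V' (hV'W.trans (hW₀ k)) (f ^ n))) = 0 := by
    have e := congrArg (secRes X' hV'W) (hrel k (f ^ n))
    rw [map_zero, map_sum] at e
    rw [← e]
    refine Finset.sum_congr rfl fun j _ => ?_
    rw [map_mul, map_sub, secRes_secRes, secRes_appLE, secRes_appLE]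
  -- `H₀ = u₀♯(fⁿ)` is a unit on `V' ⊆ u₀⁻¹D(f)`
  have hunit : IsUnit (u₀.appLE (Q k) V' (hV'W.trans (hW₀ k)) (f ^ n)) := by
    have hu1 : IsUnit (secRes Y hfQ (f ^ n)) := by
      rw [map_pow]
      exact (RingedSpace.isUnit_res_basicOpen Y.toLocallyRingedSpace.toRingedSpace f).pow n
    have e : u₀.appLE (Q k) V' (hV'W.trans (hW₀ k)) (f ^ n) =
        u₀.appLE (Y.basicOpen f) V' hV'f₀ (secRes Y hfQ (f ^ n)) := (appLE_secRes u₀ hfQ hV'f₀ (f ^ n)).symm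
    rw [e]
    exact hu1.map _
  -- Leibniz: `Σ a_j (S_j − S₀) = H₀ Σ a_j (G_j − G₀) + G₀ Σ a_j (H_j − H₀)` (products of differences vanish)
  have hLeib : (∑ j, secRes X' (le_top : V' ≤ ⊤) (a j) *
      ((u j).appLE (Q k) V' (hV'W.trans (hW k j)) s - u₀.appLE (Q k) V' (hV'W.trans (hW₀ k)) s)) =
      u₀.appLE (Q k) V' (hV'W.trans (hW₀ k)) (f ^ n) *
          ∑ j, secRes X' (le_top : V' ≤ ⊤) (a j) *
            ((u j).appLE U V' (hV'V.trans (h j)) g - u₀.appLE U V' (hV'V.trans h₀) g) +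
        u₀.appLE U V' (hV'V.trans h₀) g *
          ∑ j, secRes X' (le_top : V' ≤ ⊤) (a j) *
            ((u j).appLE (Q k) V' (hV'W.trans (hW k j)) (f ^ n) - u₀.appLE (Q k) V' (hV'W.trans (hW₀ k)) (f ^ n)) := by
    rw [Finset.mul_sum, Finset.mul_sum, ← Finset.sum_add_distrib]
    refine Finset.sum_congr rfl fun j _ => ?_
    have hz := appLE_sub_appLE_mul_appLE_sub_appLE i u₀ (u j) (u j) (hu j) (hu j)
      (hV'V.trans h₀) (hV'V.trans (h j)) (hV'W.trans (hW₀ k)) (hV'W.trans (hW k j)) g (f ^ n)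
    rw [← hGHS (u j) (hV'V.trans (h j)) (hV'W.trans (hW k j)) (hV'f j),
      ← hGHS u₀ (hV'V.trans h₀) (hV'W.trans (hW₀ k)) hV'f₀]
    linear_combination (secRes X' (le_top : V' ≤ ⊤) (a j)) * hz
  rw [hrelS, hrelH, mul_zero, add_zero] at hLeib
  exact (hunit.mul_right_eq_zero).1 hLeib.symm

end Locality

/-! ### §3 The two instances: homogeneity (`D₂ = λ D₁`) and additivity (`D₃ = D₁ + D₂`) -/

section Instances

variable [IsFirstOrderThickening i]

/-- **HOMOGENEITY IS LOCAL.**  For `u₀ u₁ u₂ : X' ⟶ Y` agreeing with `u₀` on the first-order thickening `X ↪ X'` and a global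
function `λ ∈ Γ(X', 𝒪)`: if `u₂♯ s − u₀♯ s = λ · (u₁♯ s − u₀♯ s)` on `W_k` for all sections `s` over the members `Q_k` of a family
of affine opens of `Y` with `(W_k)` covering `X'`, then `u₂♯ g − u₀♯ g = λ|_V · (u₁♯ g − u₀♯ g)` for every `g ∈ Γ(Y, U)`, every
`U`, every `V ⊆ u⁻¹U`. [cite: Hartshorne2010, §6 proof of Thm. 6.4, pp. 50–51] [cite: MumfordAV1970, §13 (proof of the Thm. pp. 125–126)] -/
theorem appLE_sub_eq_mul_sub_of_forall_affineOpen (u₀ u₁ u₂ : X' ⟶ Y) (hu₁ : i ≫ u₁ = i ≫ u₀)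
    (hu₂ : i ≫ u₂ = i ≫ u₀) (lam : Γ(X', ⊤)) {κ : Type*} (Q : κ → Y.Opens) (hQ : ∀ k, IsAffineOpen (Q k))
    (W : κ → X'.Opens) (hW₀ : ∀ k, W k ≤ u₀ ⁻¹ᵁ Q k) (hW₁ : ∀ k, W k ≤ u₁ ⁻¹ᵁ Q k) (hW₂ : ∀ k, W k ≤ u₂ ⁻¹ᵁ Q k)
    (hcov : ∀ x : X', ∃ k, x ∈ W k)
    (hrel : ∀ (k) (s : Γ(Y, Q k)),
      u₂.appLE (Q k) (W k) (hW₂ k) s - u₀.appLE (Q k) (W k) (hW₀ k) s =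
        secRes X' (le_top : W k ≤ ⊤) lam * (u₁.appLE (Q k) (W k) (hW₁ k) s - u₀.appLE (Q k) (W k) (hW₀ k) s))
    (U : Y.Opens) (g : Γ(Y, U)) (V : X'.Opens) (h₀ : V ≤ u₀ ⁻¹ᵁ U) (h₁ : V ≤ u₁ ⁻¹ᵁ U) (h₂ : V ≤ u₂ ⁻¹ᵁ U) :
    u₂.appLE U V h₂ g - u₀.appLE U V h₀ g = secRes X' (le_top : V ≤ ⊤) lam * (u₁.appLE U V h₁ g - u₀.appLE U V h₀ g) := by
  -- the relation `1 · D₂ + (−λ) · D₁ = 0`, indexed by `Fin 2` (`0 ↦ u₂`, `1 ↦ u₁`)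
  have H := sum_mul_appLE_sub_appLE_eq_zero_of_forall_affineOpen i u₀ ![u₂, u₁]
    (fun j => by fin_cases j <;> assumption) ![1, -lam] Q hQ W hW₀
    (fun k j => by fin_cases j; exacts [hW₂ k, hW₁ k]) hcov (fun k s => by
      rw [Fin.sum_univ_two]
      simp only [Matrix.cons_val_zero, Matrix.cons_val_one, map_one, one_mul, map_neg]
      rw [hrel k s]; ring) U g V h₀ (fun j => by fin_cases j; exacts [h₂, h₁])
  rw [Fin.sum_univ_two] at H
  simp only [Matrix.cons_val_zero, Matrix.cons_val_one, map_one, one_mul, map_neg] at H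
  linear_combination H

/-- **ADDITIVITY IS LOCAL.**  For `u₀ u₁ u₂ u₃ : X' ⟶ Y` agreeing with `u₀` on the first-order thickening `X ↪ X'`: if
`u₃♯ s − u₀♯ s = (u₁♯ s − u₀♯ s) + (u₂♯ s − u₀♯ s)` on `W_k` for all sections `s` over the members `Q_k` of a family of affine opens of
`Y` with `(W_k)` covering `X'`, then the same relation holds for every `g ∈ Γ(Y, U)`, every `U`, every `V ⊆ u⁻¹U`.
[cite: Hartshorne2010, §6 proof of Thm. 6.4, pp. 50–51] [cite: MumfordAV1970, §13 (proof of the Thm. pp. 125–126)] -/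
theorem appLE_sub_eq_add_sub_of_forall_affineOpen (u₀ u₁ u₂ u₃ : X' ⟶ Y) (hu₁ : i ≫ u₁ = i ≫ u₀)
    (hu₂ : i ≫ u₂ = i ≫ u₀) (hu₃ : i ≫ u₃ = i ≫ u₀) {κ : Type*} (Q : κ → Y.Opens) (hQ : ∀ k, IsAffineOpen (Q k))
    (W : κ → X'.Opens) (hW₀ : ∀ k, W k ≤ u₀ ⁻¹ᵁ Q k) (hW₁ : ∀ k, W k ≤ u₁ ⁻¹ᵁ Q k) (hW₂ : ∀ k, W k ≤ u₂ ⁻¹ᵁ Q k)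
    (hW₃ : ∀ k, W k ≤ u₃ ⁻¹ᵁ Q k) (hcov : ∀ x : X', ∃ k, x ∈ W k)
    (hrel : ∀ (k) (s : Γ(Y, Q k)),
      u₃.appLE (Q k) (W k) (hW₃ k) s - u₀.appLE (Q k) (W k) (hW₀ k) s =
        (u₁.appLE (Q k) (W k) (hW₁ k) s - u₀.appLE (Q k) (W k) (hW₀ k) s) +
          (u₂.appLE (Q k) (W k) (hW₂ k) s - u₀.appLE (Q k) (W k) (hW₀ k) s))
    (U : Y.Opens) (g : Γ(Y, U)) (V : X'.Opens) (h₀ : V ≤ u₀ ⁻¹ᵁ U) (h₁ : V ≤ u₁ ⁻¹ᵁ U) (h₂ : V ≤ u₂ ⁻¹ᵁ U)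
    (h₃ : V ≤ u₃ ⁻¹ᵁ U) :
    u₃.appLE U V h₃ g - u₀.appLE U V h₀ g =
      (u₁.appLE U V h₁ g - u₀.appLE U V h₀ g) + (u₂.appLE U V h₂ g - u₀.appLE U V h₀ g) := by
  -- the relation `1 · D₃ + (−1) · D₁ + (−1) · D₂ = 0`, indexed by `Fin 3` (`0 ↦ u₃`, `1 ↦ u₁`, `2 ↦ u₂`)
  have H := sum_mul_appLE_sub_appLE_eq_zero_of_forall_affineOpen i u₀ ![u₃, u₁, u₂]
    (fun j => by fin_cases j <;> assumption) ![1, -1, -1] Q hQ W hW₀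
    (fun k j => by fin_cases j; exacts [hW₃ k, hW₁ k, hW₂ k]) hcov (fun k s => by
      rw [Fin.sum_univ_three]
      simp only [Matrix.cons_val_zero, Matrix.cons_val_one, Matrix.cons_val, map_one, one_mul, map_neg]
      rw [hrel k s]; ring) U g V h₀ (fun j => by fin_cases j; exacts [h₃, h₁, h₂])
  rw [Fin.sum_univ_three] at H
  simp only [Matrix.cons_val_zero, Matrix.cons_val_one, Matrix.cons_val, map_one, one_mul, map_neg] at H
  linear_combination H

end Instances

end Literature.AlgebraicGeometry.Deformation

end
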